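import Mathlib
import HarnessLib

/-!
# Venture HSemireg — the degree-one supertrace law (Σ) for two-level reduced-point complexes

HONEST FRAMING. Lean leaf for the computation cell `pub-hsemireg` (target seat t-5 gen 14; file of
record `run/shared/lean/pub/pub-hsemireg/target-g6/W3-SIGMA-t5g14.md` §0 (D), §3.3 (i),
2026-08-23). In the minimal twisted-complex model of a «reduced-point complex» on a smooth threefold
germ (W3-PATHALG-t5g13 §1) the Killing relation (E1) for two coordinate directions `t, s` reads,
with `a = u(t)`, `b = u(s)` (raising the level) and `c = V(s)`, `e = V(t)` (lowering it),
`{a,e} = 0`, `{b,c} = 0`, `{a,c} + {b,e} = 0` on every level. The law (Σ) of the note says that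
the alternating sum over levels of the traces of the loops `a ∘ c` vanishes — equivalently that the
level-trace polynomial of every single W-class component is divisible by `(1+z)²`; it is NOT a
linear consequence of (E1) (§3.2 of the note) and is conjectural in general. THIS FILE kernel-checks
its first case, two levels `V` (bottom) and `W` (top): there the loop `a ∘ c : W → W` squares to
zero, because `c ∘ a = -(e ∘ b)` on `V` and `a ∘ e = 0` on `W`, hence its trace vanishes
(nilpotent ⇒ traceless — the non-formal step). Only these two relations are used. The model, the
note's numerics and everything about ≥ 3 levels are NOT formalised. No object is constructed;
nothing here bears on HC, HC_CM or HC_AV.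
-/

namespace Summit.Ventures.HSemireg

open LinearMap

variable {F : Type*} [Field F]
variable {V W : Type*} [AddCommGroup V] [Module F V] [AddCommGroup W] [Module F W]

/-- **The two-level loop squares to zero.** If `c ∘ a + e ∘ b = 0` on the bottom level and
`a ∘ e = 0` on the top level, then `(a ∘ c) ∘ (a ∘ c) = 0` on the top level:
`a (c a) c = -a (e b) c = -(a e)(b c) = 0`. [folklore] -/
theorem sigmaLoop_comp_self_eq_zero (a b : V →ₗ[F] W) (c e : W →ₗ[F] V)
    (hiii : c ∘ₗ a + e ∘ₗ b = 0) (hi : a ∘ₗ e = 0) :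
    (a ∘ₗ c) ∘ₗ (a ∘ₗ c) = 0 := by
  have hca : c ∘ₗ a = -(e ∘ₗ b) := eq_neg_of_add_eq_zero_left hiii
  calc (a ∘ₗ c) ∘ₗ (a ∘ₗ c) = a ∘ₗ (c ∘ₗ a) ∘ₗ c := by
        simp only [LinearMap.comp_assoc]
    _ = -((a ∘ₗ e) ∘ₗ (b ∘ₗ c)) := by
        rw [hca, LinearMap.neg_comp, LinearMap.comp_neg]
        simp only [LinearMap.comp_assoc]
    _ = 0 := by rw [hi, LinearMap.zero_comp, neg_zero]

/-- **(Σ) for two levels, top trace.** Under the two Killing relations `c ∘ a + e ∘ b = 0` (bottom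
level) and `a ∘ e = 0` (top level) the loop `a ∘ c` on the finite-dimensional top level has trace
zero (W3-SIGMA-t5g14 §3.3 (i)): it is nilpotent by `sigmaLoop_comp_self_eq_zero`. [folklore] -/
theorem trace_sigmaLoop_eq_zero [FiniteDimensional F W] (a b : V →ₗ[F] W) (c e : W →ₗ[F] V)
    (hiii : c ∘ₗ a + e ∘ₗ b = 0) (hi : a ∘ₗ e = 0) :
    LinearMap.trace F W (a ∘ₗ c) = 0 := by
  have hsq : (a ∘ₗ c) * (a ∘ₗ c) = 0 := sigmaLoop_comp_self_eq_zero a b c e hiii hi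
  have hnil : IsNilpotent (a ∘ₗ c) := ⟨2, by rw [pow_two, hsq]⟩
  exact (LinearMap.isNilpotent_trace_of_isNilpotent hnil).eq_zero

/-- **(Σ) for two levels, bottom trace.** Same hypotheses, both levels finite-dimensional: the loop
`c ∘ a` on the bottom level has trace zero as well (`trace (c ∘ a) = trace (a ∘ c)`), so the
alternating sum of the loop traces over the two levels — the supertrace `str(u(t)V(s))` of the
note — vanishes term by term. [folklore] -/
theorem trace_sigmaLoop_eq_zero' [FiniteDimensional F V] [FiniteDimensional F W]
    (a b : V →ₗ[F] W) (c e : W →ₗ[F] V)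
    (hiii : c ∘ₗ a + e ∘ₗ b = 0) (hi : a ∘ₗ e = 0) :
    LinearMap.trace F V (c ∘ₗ a) = 0 := by
  rw [LinearMap.trace_comp_comm', trace_sigmaLoop_eq_zero a b c e hiii hi]

end Summit.Ventures.HSemireg
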